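import Summits.CriticalPhenomena.Ising3DConformalLimit.Theorems.SynchronousCouplingRotationJoiningIsotropyTransfer
import Summits.CriticalPhenomena.Ising3DConformalLimit.Theorems.SynchronousCouplingRotationJoiningSplittingTransfer
import Summits.CriticalPhenomena.Ising3DConformalLimit.Theorems.SynchronousCouplingRotationJoiningTiltedTransfer
import Summits.CriticalPhenomena.Ising3DConformalLimit.Theorems.SynchronousCouplingRotationJoiningMomentsToTests
import HarnessLib

/-!
# Route `SynchronousCoupling`: the crux `RotationJoining` (stmt-CriticalPhenomena-18763) follows from the route's two
# other open cruxes `DilationJoinings` (stmt-18762) and `UniformRegularity` (stmt-4658)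

This is the composition of the line `SketchIdeator2` (card `rate-from-dilations-splitting`, reshape 2) with every stub
landed except the route inputs themselves:
`DilationJoinings ∧ UniformRegularity ⟹ TwoPointToolkit, BallSums` (`stub_twoPointToolkit`, `stub_ballSumRatio`),
`⟹ DilationJoiningsTilted` (`stub_tiltedTransfer`, Kozma's commensurate rotation `ψ = ⌊A·/3⌋` and the decomposition of
tilted cells into fine axis cells), `⟹ AsymptoticFDDIsotropy` (`stub_isotropyTransfer`: pinned scaling limit of the funnel,
its rotation invariance, Newman's Gaussian bound, method of moments), and lead 0's rate bootstrap
`rotationJoining_of_dilationJoinings_tilted_fddIsotropy`. Hence the route's deciding theorem, which consumes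
`DilationJoinings` and `UniformRegularity` anyway, no longer needs `RotationJoining` as an independent input.
A CONDITIONAL result (the two hypotheses are open items of the route); no definitions, no sorry.
-/

namespace Summit.CriticalPhenomena.Ising3DConformalLimit.Cruxes.RotationJoining.RateSplitting

open Summit.CriticalPhenomena.Ising3DConformalLimit.Theses

noncomputable section

/-- **Registered sub-goal `rotationJoining_of_routeCruxes`: `DilationJoinings → UniformRegularity → RotationJoining`.**
The window-uniform power-rate rotation joining of the critical `3D` Ising block spins (crux stmt-CriticalPhenomena-18763)
follows from the route's cruxes stmt-18762 and stmt-4658. -/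
theorem rotationJoining_of_routeCruxes (hDJ : SynchronousCoupling.DilationJoinings)
    (hUR : SynchronousCoupling.UniformRegularity) :
    Summit.CriticalPhenomena.Ising3DConformalLimit.Theses.SynchronousCoupling.RotationJoining := by
  have hTK : TwoPointToolkit := stub_twoPointToolkit hDJ hUR
  have hBS : BallSums :=
    Cruxes.JoiningsTransfer.Sketch.stub_ballSumRatio
      (Cruxes.ExistsScaleCovariantLimit.TwoHierarchies.ItemMaps.uniformRegularity_iff_doubling.1
        (Cruxes.JoiningsTransfer.Sketch.synchronousCoupling_uniformRegularity_iff.1 hUR))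
  exact rotationJoining_of_dilationJoinings_tilted_fddIsotropy hDJ (stub_tiltedTransfer hTK stub_tiltGeometry hBS hDJ)
    (stub_isotropyTransfer hTK stub_tiltGeometry hBS stub_newmanBlocks stub_momentsToTests hDJ hUR)

end

end Summit.CriticalPhenomena.Ising3DConformalLimit.Cruxes.RotationJoining.RateSplitting
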